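import Summits.AtomisticToContinuum.FouriersLaw.Theorems.CageBudgetFeketeHeatVarianceCalculusCanonicalMajorant
import Summits.AtomisticToContinuum.FouriersLaw.Theorems.EmbeddedDrudeMourreDrudeDissolutionStubPolynomialStationarity
import Summits.AtomisticToContinuum.FouriersLaw.Theorems.EmbeddedDrudeMourreDrudeDissolutionStubPencilDerivationFoelner
import Literature.MathematicalPhysics.KineticTheory.InfiniteChainObservables
import HarnessLib

/-!
# Stub `stub_staticFoelner` (S3) of line `dual-certificate`
(crux `CageBudgetFekete.HeatVarianceCeiling`, item stmt-AtomisticToContinuum-15770; `--supports` file, closes nothing;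
line lead, 2026-08-17)

WHAT. The registered STATIC stub S3 of the skeleton `Cruxes/HeatVarianceCeiling/Lines/dual_certificate.lean`:
for the pinned anharmonic chain `P = pinnedChain ω₂ lam β γ` (`ω₂, lam, β > 0`), a shift- and reversal-invariant
DLR Gibbs state `μ` at `T > 0` and a bounded `C¹` local test observable `u`, the normalised block variances
`n⁻¹ Var_μ(Σ_{i<n} f∘τ_i)` converge to the zero-wavenumber bracket `⟪f,f⟫ = Σ_{x∈ℤ} Cov_μ(f, f∘τ_x)` for
`f = u` and for `f = r := j₀ − 𝒜u` (`𝒜 = liouvilleZ P`, `j₀ = P.bondCurrentZ · 0`). No dynamics enters.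

HOW. (M) DLR uniqueness (`eq_of_isChainGibbsMeasure_of_isShiftInvariant_pinnedChain`) identifies `μ` with the
exponentially ρ-mixing transfer-operator state of `Theorems.MourreDissolution.exists_gibbsState_mixing_pinnedChain`;
(C) for a box-local, measurable, square-integrable `f` the two-point function `x ↦ Cov_μ(f, f∘τ_x)` is summable by
the clustering transfer with the trivial approximants `h_n = f` (`summable_covariance_comp_chainShift`);
(F) the Følner limit `n⁻¹ Var(Σ_{i<n} f∘τ_i) → Σ_x Cov(f, f∘τ_x)` is the tree's
`GramPencilHarmonicChaos.tendsto_inv_mul_variance_birkhoffSum` (Tannery), and `Cov(f, f∘τ_x) = ∫ f·(f∘τ_x) − (∫f)²`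
by translation invariance; (L) locality / measurability / `L²` of `u = g ∘ boxRestrict R` (bounded) and of
`r = j₀ − 𝒜u` (box formula `liouvilleZ_comp_boxRestrict`, `|𝒜u| ≤ C Σ (|p_x| + |F_x|)` with all moments of the
local polynomials `p_x`, `F_x` finite in the thermal state, `measurable_and_integrable_pow_of_mem_polyObs`).
-/

noncomputable section

namespace Summit.AtomisticToContinuum.FouriersLaw.Theorems.HeatVarianceCeiling.DualCertificate

open MeasureTheory ProbabilityTheory Filter Set Function
open scoped Topology BigOperators
open Literature.MathematicalPhysics.KineticTheory
open Literature.MathematicalPhysics.KineticTheory.HeatConduction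

/-! ## Locality bookkeeping -/

/-- Two configurations agreeing on the centred box `[-R, R]` have the same box restriction. [folklore] -/
theorem sf_boxRestrict_congr {R : ℕ} {σ σ' : ChainConfig}
    (h : ∀ i ∈ Icc (-(R : ℤ)) R, σ i = σ' i) : boxRestrict R σ = boxRestrict R σ' := by
  funext i
  have hi := i.isLt
  simp only [boxRestrict_apply]
  exact h _ ⟨by omega, by omega⟩

/-- A profile on the centred box `[-R, R]` depends on the sites of that box only. [folklore] -/
theorem sf_dependsOn_comp_boxRestrict {β : Type*} (R : ℕ) (g : (Fin (2 * R + 1) → ℝ × ℝ) → β) :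
    DependsOn (g ∘ boxRestrict R) (Icc (-(R : ℤ)) R) := by
  intro σ σ' h
  simp only [comp_apply, sf_boxRestrict_congr h]

/-- **Locality of `𝒜(g ∘ box_R)`**: by the box formula it involves the momenta of the box, the forces
on the box (sites `[-R-1, R+1]`) and `Dg` at the box restriction, hence depends on the sites
`[-R-1, R+1]` only. [folklore] -/
theorem sf_dependsOn_liouvilleZ_comp_boxRestrict (P : OscillatorChain) (R : ℕ)
    {g : (Fin (2 * R + 1) → ℝ × ℝ) → ℝ} (hg : ContDiff ℝ 1 g) :
    DependsOn (liouvilleZ P (g ∘ boxRestrict R)) (Icc (-(R : ℤ) - 1) (R + 1)) := by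
  intro σ σ' h
  have hb : boxRestrict R σ = boxRestrict R σ' :=
    sf_boxRestrict_congr fun i hi => h i ⟨by linarith [hi.1], by linarith [hi.2]⟩
  rw [liouvilleZ_comp_boxRestrict P R σ ((hg.differentiable one_ne_zero) _),
    liouvilleZ_comp_boxRestrict P R σ' ((hg.differentiable one_ne_zero) _), hb]
  refine Finset.sum_congr rfl fun i _ => ?_
  have hi := i.isLt
  have h0 : σ ((i : ℤ) - R) = σ' ((i : ℤ) - R) := h _ ⟨by omega, by omega⟩
  have hp : σ ((i : ℤ) - R + 1) = σ' ((i : ℤ) - R + 1) := h _ ⟨by omega, by omega⟩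
  have hm : σ ((i : ℤ) - R - 1) = σ' ((i : ℤ) - R - 1) := h _ ⟨by omega, by omega⟩
  rw [h0, OscillatorChain.force_congr_of_eq (congrArg Prod.fst h0) (congrArg Prod.fst hp)
    (congrArg Prod.fst hm)]

/-! ## The Følner limit for a box-local square-integrable observable of a mixing state -/

/-- **Static Følner limit in the stub's spelling.** For a translation-invariant probability measure
`μ` on chain configurations which is exponentially ρ-mixing between half-lines, and a box-local,
measurable, square-integrable observable `f`:
`n⁻¹ Var_μ(Σ_{i<n} f(σ_{·+i})) → Σ_{x∈ℤ} (∫ f·f(σ_{·+x}) dμ − (∫ f dμ)²)` — the two-point function is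
summable by the clustering transfer, the limit is Tannery's theorem
(`tendsto_inv_mul_variance_birkhoffSum`), and `Cov(f, f∘τ_x) = ∫ f·(f∘τ_x) − ∫f ∫f` by invariance.
[cite: Doyon2022, §4.1 Lemma 4.5] -/
theorem sf_tendsto_inv_mul_variance_of_local {μ : Measure ChainConfig} [IsProbabilityMeasure μ]
    {C m : ℝ}
    (hmix : ∀ (p : ℤ) (n : ℕ) (f g : ChainConfig → ℝ),
      DependsOn f {i : ℤ | i ≤ p} → DependsOn g {i : ℤ | p + n ≤ i} →
      Measurable f → Measurable g → MemLp f 2 μ → MemLp g 2 μ →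
      |MeasureTheory.integral μ (fun σ => f σ * g σ) -
          MeasureTheory.integral μ f * MeasureTheory.integral μ g| ≤
        C * Real.exp (-(m * n)) * (MeasureTheory.integral μ (fun σ => f σ ^ 2)) ^ (1 / 2 : ℝ) *
          (MeasureTheory.integral μ (fun σ => g σ ^ 2)) ^ (1 / 2 : ℝ))
    (hm : 0 < m) (hτ : ∀ x : ℤ, MeasurePreserving (chainShift x) μ μ)
    {f : ChainConfig → ℝ} {M : ℕ} (hf : DependsOn f (Icc (-(M : ℤ)) M)) (hfm : Measurable f)
    (hf2 : MemLp f 2 μ) :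
    Tendsto (fun n : ℕ => (n : ℝ)⁻¹ *
        Var[fun σ : ChainConfig => ∑ i ∈ Finset.range n, f (fun k : ℤ => σ (k + (i : ℤ))); μ]) atTop
      (𝓝 (∑' x : ℤ, ((∫ σ, f σ * f (fun i => σ (i + x)) ∂μ) - (∫ σ, f σ ∂μ) * (∫ σ, f σ ∂μ)))) := by
  -- (C) summable clustering of the two-point function (trivial approximants `h_n = f`)
  have hsum : Summable fun x : ℤ => cov[f, f ∘ chainShift x; μ] :=
    summable_covariance_comp_chainShift hmix hm hτ hf hfm hf2 M hfm hf2 (ε := fun _ => (0 : ℝ))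
      (fun _ => le_rfl) summable_zero fun n =>
        ⟨f, hf.mono (Icc_subset_Icc (by omega) (by omega)), hfm, hf2, by simp⟩
  -- (F) the Følner limit (Tannery)
  have hlim := Summit.AtomisticToContinuum.FouriersLaw.Theorems.DrudeDissolution.GramPencilHarmonicChaos.tendsto_inv_mul_variance_birkhoffSum
    chainShift hτ hf2 hsum.abs
  -- the block sums and the terms in the stub's spelling
  have hA : ∀ n : ℕ, (fun σ : ChainConfig => ∑ i ∈ Finset.range n, f (fun k : ℤ => σ (k + (i : ℤ)))) =
      ∑ i ∈ Finset.range n, f ∘ chainShift (i : ℤ) := by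
    intro n
    funext σ
    simp only [Finset.sum_apply, comp_apply]
    rfl
  have hterm : ∀ x : ℤ, cov[f, f ∘ chainShift x; μ] =
      (∫ σ, f σ * f (fun i => σ (i + x)) ∂μ) - (∫ σ, f σ ∂μ) * (∫ σ, f σ ∂μ) := by
    intro x
    rw [covariance_eq_sub hf2 (hf2.comp_measurePreserving (hτ x))]
    have h1 : (∫ σ, (f ∘ chainShift x) σ ∂μ) = ∫ σ, f σ ∂μ :=
      integral_comp_chainShift (hτ x) hf2.aestronglyMeasurable
    rw [h1]
    rfl
  have e1 : (fun n : ℕ => (n : ℝ)⁻¹ *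
      Var[fun σ : ChainConfig => ∑ i ∈ Finset.range n, f (fun k : ℤ => σ (k + (i : ℤ))); μ]) =
      fun n : ℕ => (n : ℝ)⁻¹ * Var[∑ i ∈ Finset.range n, f ∘ chainShift (i : ℤ); μ] :=
    funext fun n => by rw [hA n]
  have e2 : ∑' x : ℤ, ((∫ σ, f σ * f (fun i => σ (i + x)) ∂μ) - (∫ σ, f σ ∂μ) * (∫ σ, f σ ∂μ)) =
      ∑' x : ℤ, cov[f, f ∘ chainShift x; μ] :=
    tsum_congr fun x => (hterm x).symm
  rw [e1, e2]
  exact hlim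

/-! ## The stub -/

/-- **Stub `stub_staticFoelner` (S3; registered signature, verbatim).** For the shift- and
reversal-invariant DLR Gibbs state `μ` of `pinnedChain ω₂ lam β γ` (`ω₂, lam, β > 0`) at `T > 0` and a
bounded `C¹` local test observable `u`: with `r = j₀ − 𝒜u`, `A_n f = Σ_{i<n} f∘τ_i` and
`⟪f₁,f₂⟫ = Σ_x (∫ f₁·(f₂∘τ_x) dμ − ∫f₁ ∫f₂)`,
`n⁻¹ Var_μ(A_n u) → ⟪u,u⟫` and `n⁻¹ Var_μ(A_n r) → ⟪r,r⟫` (STATIC: no dynamics).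
[cite: Doyon2022, §4.1 Def. 4.3 and Lemma 4.5] -/
theorem stub_staticFoelner :
    ∀ ω₂ lam β γ : ℝ, 0 < ω₂ → 0 < lam → 0 < β → ∀ T : ℝ, 0 < T → ∀ μ : MeasureTheory.Measure Literature.MathematicalPhysics.KineticTheory.HeatConduction.ChainConfig, (Literature.MathematicalPhysics.KineticTheory.HeatConduction.pinnedChain ω₂ lam β γ).IsChainGibbsMeasure T μ → Literature.MathematicalPhysics.KineticTheory.HeatConduction.IsShiftInvariant μ → μ.map (fun σ : Literature.MathematicalPhysics.KineticTheory.HeatConduction.ChainConfig => fun x : ℤ => ((σ x).1, -(σ x).2)) = μ →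
      ∀ u : Literature.MathematicalPhysics.KineticTheory.HeatConduction.ChainConfig → ℝ,
        Literature.MathematicalPhysics.KineticTheory.HeatConduction.IsLocalTestFunction u →
          let P := Literature.MathematicalPhysics.KineticTheory.HeatConduction.pinnedChain ω₂ lam β γ
          let r : Literature.MathematicalPhysics.KineticTheory.HeatConduction.ChainConfig → ℝ := fun σ => P.bondCurrentZ σ 0 - Literature.MathematicalPhysics.KineticTheory.HeatConduction.liouvilleZ P u σ
          let A : ℕ → (Literature.MathematicalPhysics.KineticTheory.HeatConduction.ChainConfig → ℝ) →
              Literature.MathematicalPhysics.KineticTheory.HeatConduction.ChainConfig → ℝ := fun n f σ => ∑ i ∈ Finset.range n, f (fun k : ℤ => σ (k + (i : ℤ)))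
          let br : (Literature.MathematicalPhysics.KineticTheory.HeatConduction.ChainConfig → ℝ) →
              (Literature.MathematicalPhysics.KineticTheory.HeatConduction.ChainConfig → ℝ) → ℝ := fun f₁ f₂ => ∑' x : ℤ, ((∫ σ, f₁ σ * f₂ (fun i => σ (i + x)) ∂μ) - (∫ σ, f₁ σ ∂μ) * (∫ σ, f₂ σ ∂μ))
          Filter.Tendsto (fun n : ℕ => (n : ℝ)⁻¹ * ProbabilityTheory.variance (A n u) μ) Filter.atTop (nhds (br u u)) ∧
          Filter.Tendsto (fun n : ℕ => (n : ℝ)⁻¹ * ProbabilityTheory.variance (A n r) μ) Filter.atTop (nhds (br r r)) := by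
  intro ω₂ lam β γ hω hl hβ T hT μ hG hSI _hR u hu
  dsimp only
  -- (M): the given shift-invariant DLR state IS the mixing transfer-operator state (uniqueness)
  obtain ⟨μ', hG', hS', hss', -, C, m, hm, hmix⟩ :=
    Summit.AtomisticToContinuum.FouriersLaw.Theorems.MourreDissolution.exists_gibbsState_mixing_pinnedChain
      ω₂ lam β γ hω hl.le hβ.le T hT
  have hμμ' : μ = μ' :=
    OscillatorChain.eq_of_isChainGibbsMeasure_of_isShiftInvariant_pinnedChain γ hω hl.le hβ.le hT hG hSI hG' hS'
  subst hμμ'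
  haveI : IsProbabilityMeasure μ := hss'.1
  have hτ : ∀ x : ℤ, MeasurePreserving (chainShift x) μ μ := hSI.measurePreserving_chainShift
  -- (L) for `u = g ∘ boxRestrict R`: bounded, measurable, local
  obtain ⟨R, g, hg, -, -, hu_eq⟩ := id hu
  have hum : Measurable u := hu.measurable
  obtain ⟨Mb, hMb⟩ := hu.exists_bound
  have hu2 : MemLp u 2 μ :=
    MemLp.of_bound hum.aestronglyMeasurable Mb
      (Eventually.of_forall fun σ => by rw [Real.norm_eq_abs]; exact hMb σ)
  have hu_dep : DependsOn u (Icc (-(R : ℤ)) R) := by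
    rw [hu_eq]; exact sf_dependsOn_comp_boxRestrict R g
  refine ⟨sf_tendsto_inv_mul_variance_of_local hmix hm hτ hu_dep hum hu2, ?_⟩
  -- (L) for `r = j₀ − 𝒜u`: local on `[-(R+1), R+1]`, measurable, square integrable
  have hrm : Measurable fun σ : ChainConfig =>
      (pinnedChain ω₂ lam β γ).bondCurrentZ σ 0 - liouvilleZ (pinnedChain ω₂ lam β γ) u σ :=
    (measurable_bondCurrentZ _ 0).sub (hu.measurable_liouvilleZ _)
  have hr_dep : DependsOn (fun σ : ChainConfig =>
      (pinnedChain ω₂ lam β γ).bondCurrentZ σ 0 - liouvilleZ (pinnedChain ω₂ lam β γ) u σ)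
      (Icc (-((R + 1 : ℕ) : ℤ)) (R + 1 : ℕ)) := by
    intro σ σ' h
    have hj : (pinnedChain ω₂ lam β γ).bondCurrentZ σ 0 = (pinnedChain ω₂ lam β γ).bondCurrentZ σ' 0 :=
      OscillatorChain.dependsOn_bondCurrentZ_zero _ fun i hi =>
        h i ⟨by have := hi.1; omega, by have := hi.2; omega⟩
    have hA : liouvilleZ (pinnedChain ω₂ lam β γ) u σ = liouvilleZ (pinnedChain ω₂ lam β γ) u σ' := by
      rw [hu_eq]
      exact sf_dependsOn_liouvilleZ_comp_boxRestrict _ R hg fun i hi =>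
        h i ⟨by have := hi.1; omega, by have := hi.2; omega⟩
    dsimp only
    rw [hj, hA]
  -- all moments of the local polynomials `p_z`, `F_z` are finite in the thermal state
  have hgen : ∀ f : ChainConfig → ℝ, f ∈ Algebra.adjoin ℝ (Set.range fun xc : ℤ × Bool =>
      fun σ : ChainConfig => if xc.2 then (σ xc.1).2 else (σ xc.1).1) → MemLp f 2 μ := fun f hf => by
    have h := Summit.AtomisticToContinuum.FouriersLaw.Theorems.DrudeDissolution.GramPencilHarmonicChaos.measurable_and_integrable_pow_of_mem_polyObs
      γ hω hl.le hβ.le hT hG hSI hf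
    exact OscillatorChain.memLp_of_integrable_abs_pow h.1.aestronglyMeasurable h.2 ENNReal.ofNat_ne_top
  have hp2 : ∀ z : ℤ, MemLp (fun σ : ChainConfig => (σ z).2) 2 μ := fun z =>
    hgen _ (Algebra.subset_adjoin ⟨(z, true), by funext σ; simp⟩)
  have hF2 : ∀ z : ℤ, MemLp (fun σ : ChainConfig => (pinnedChain ω₂ lam β γ).force σ z) 2 μ := fun z =>
    hgen _ (Summit.AtomisticToContinuum.FouriersLaw.Theorems.DrudeDissolution.GramPencilHarmonicChaos.force_pinnedChain_mem
      ω₂ lam β γ z _ fun z' => Algebra.subset_adjoin ⟨(z', false), by funext σ; simp⟩)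
  -- `𝒜u ∈ L²(μ)` by the growth bound `|𝒜u| ≤ C Σ (|p| + |F|)`
  have hAu2 : MemLp (liouvilleZ (pinnedChain ω₂ lam β γ) u) 2 μ := by
    obtain ⟨R', C', -, hC'⟩ := hu.exists_abs_liouvilleZ_le (pinnedChain ω₂ lam β γ)
    have habs : ∀ z : ℤ, MemLp (fun σ : ChainConfig =>
        |(σ z).2| + |(pinnedChain ω₂ lam β γ).force σ z|) 2 μ := fun z =>
      (hp2 z).norm.add (hF2 z).norm
    have hS : MemLp (fun σ : ChainConfig => ∑ i : Fin (2 * R' + 1),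
        (|(σ ((i : ℤ) - R')).2| + |(pinnedChain ω₂ lam β γ).force σ ((i : ℤ) - R')|)) 2 μ :=
      memLp_finsetSum _ fun i _ => habs _
    refine MemLp.of_le_mul (c := C') hS ((hu.measurable_liouvilleZ _).aestronglyMeasurable)
      (Eventually.of_forall fun σ => ?_)
    have h0 : 0 ≤ ∑ i : Fin (2 * R' + 1),
        (|(σ ((i : ℤ) - R')).2| + |(pinnedChain ω₂ lam β γ).force σ ((i : ℤ) - R')|) :=
      Finset.sum_nonneg fun i _ => add_nonneg (abs_nonneg _) (abs_nonneg _)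
    rw [Real.norm_eq_abs, Real.norm_eq_abs, abs_of_nonneg h0]
    exact hC' σ
  have hj2 : MemLp (fun σ : ChainConfig => (pinnedChain ω₂ lam β γ).bondCurrentZ σ 0) 2 μ :=
    OscillatorChain.memLp_bondCurrentZ_pinnedChain γ hω.le hl.le hβ hss' 0 ENNReal.ofNat_ne_top
  have hr2 : MemLp (fun σ : ChainConfig =>
      (pinnedChain ω₂ lam β γ).bondCurrentZ σ 0 - liouvilleZ (pinnedChain ω₂ lam β γ) u σ) 2 μ :=
    hj2.sub hAu2
  exact sf_tendsto_inv_mul_variance_of_local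
    (f := fun σ : ChainConfig =>
      (pinnedChain ω₂ lam β γ).bondCurrentZ σ 0 - liouvilleZ (pinnedChain ω₂ lam β γ) u σ)
    hmix hm hτ hr_dep hrm hr2

end Summit.AtomisticToContinuum.FouriersLaw.Theorems.HeatVarianceCeiling.DualCertificate

end
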